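import Summits.BirchSwinnertonDyer.BirchSwinnertonDyer.Theorems.EisensteinPrimesGorensteinDefectCriterion
import Mathlib.NumberTheory.Multiplicity
import HarnessLib

/-!
# Hida-family weight bookkeeping at `p` as kernel lemmas — the DEPTH of a weight
# (`v_p((1+p)ⁿ − 1) = v_p(n) + 1`, lifting-the-exponent), the ordinary root mod `p`
# (`X² − aX + p^{k−1} ≡ X(X − a)`), and «every lift of `Φ̄` reduces to ONE series under every weight»
# (MEMO-23 §1 / MEMO-24 §1 NOTATION, (a)(i), (b) CLAIM 1–2 shadow) (cell `bsd-eis`, seat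
# `bsd-line-x2-p2` gen 2, D-0154 KEY row 5; route `EisensteinPrimes`, crux 4 `BSDpOnCellC`
# stmt-BirchSwinnertonDyer-19034 line b1 v10 / crux 3; companions p607009, p610475, p611136)

HONEST FRAMING (cell `bsd-eis`, run/shared/lean/pub/bsd-eis/): elementary arithmetic and commutative
algebra (Mathlib + the companions); NO Hida family, Hecke operator or `L`-function is constructed — the
memo's readings («depth of the weight-`k` member», «`U₃ ≡ a₃(E)` on the stabilised old form»,
«`L_p(Φ(x)) mod ϖ_x = L̄(Φ̄)`») stay memo-level; nothing booked; no label or count moves; BSD and the main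
conjectures are proved for no curve. Helper attached to stmt-BirchSwinnertonDyer-19034 (`--supports`).

## Contents

* §1 `padicValNat_one_add_pow_sub_one` — for an odd prime `p` and `n ≠ 0`:
  `v_p((1+p)ⁿ − 1) = v_p(n) + 1` (Mathlib's lifting-the-exponent `padicValNat.pow_sub_pow` at
  `x = 1 + p`, `y = 1`): MEMO-24 §1's «`v₃(s_k) = v₃(k−2) + 1` = depth of the weight» with
  `s_k = 4^{k−2} − 1 = (1+3)^{k−2} − 1`; and `pow_dvd_one_add_pow_sub_one_iff` (`p^m ∣ (1+p)ⁿ − 1 ⟺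
  m ≤ v_p(n) + 1`), the form in which «depth-`m` member» is used by the `lcongr(m)` door (p573328).
* §2 `stabilisation_charpoly_mod_p` — in `𝔽_p[X]`, `X² − aX + p^{k−1} = X·(X − a)` for `k ≥ 2`: the
  `p`-stabilised old form's `U_p`-eigenvalues reduce to `{0, a_p}`, the ordinary one to `a_p`
  (MEMO-24 §1 (a)(i): «`U₃ ≡ a₃(g)` because the correction term carries `3^{k−1}`»).
* §3 `redFam_apply_eq_of_sub_mem`, `red_map_apply_eq_of_sub_mem` — for a `Λ_S`-linear
  `L : W → Λ_S⟦T⟧` (memo: the two-variable `L`-function on `𝕎`), `Φ ≡ Ψ (mod 𝔪_{Λ_S}W)` ⟹ `L Φ` and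
  `L Ψ` have the same double reduction, hence (p610475 §2) `red (map φ₁ (L Φ)) = red (map φ₂ (L Ψ))` for
  ANY two weights `φ₁, φ₂`: «all weights reduce through the same map `W → W̄ → 𝔽_p⟦T⟧`» (CLAIM 1 with
  the algebraic shadow of CLAIM 2).

References: [Washington1997] §7.1; lifting-the-exponent (Mathlib `Mathlib.NumberTheory.Multiplicity`);
cell memos cgshw MEMO-23 §1, MEMO-24 §1 e922e989f5e38c02; companions p573328, p607009, p610475, p611136.
-/

set_option autoImplicit false
set_option linter.dupNamespace false -- the summit namespace `…BirchSwinnertonDyer.BirchSwinnertonDyer.Theorems` (Sub = Summit, D-0017) trips it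

noncomputable section

open scoped Classical

open IsLocalRing

namespace Summit.BirchSwinnertonDyer.BirchSwinnertonDyer.Theorems.HidaWeightBookkeeping

/-! ## §1. The depth of a weight: `v_p((1+p)ⁿ − 1) = v_p(n) + 1` -/

/-- **Depth of the weight (lifting the exponent).** For an odd prime `p` and `n ≠ 0`:
`v_p((1+p)ⁿ − 1) = v_p(n) + 1`. With `p = 3`, `n = k − 2`: MEMO-24 §1's `v₃(s_k) = v₃(k−2) + 1`,
`s_k = 4^{k−2} − 1`. [folklore] -/
theorem padicValNat_one_add_pow_sub_one {p : ℕ} [hp : Fact p.Prime] (hodd : Odd p) {n : ℕ}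
    (hn : n ≠ 0) : padicValNat p ((1 + p) ^ n - 1) = padicValNat p n + 1 := by
  have hx : ¬ p ∣ 1 + p := by
    rw [Nat.dvd_add_left (dvd_refl p), Nat.dvd_one]; exact hp.out.ne_one
  have h := padicValNat.pow_sub_pow (p := p) (x := 1 + p) (y := 1) (hp1 := hodd)
    (hyx := by have := hp.out.one_lt; omega) (hxy := by rw [Nat.add_sub_cancel_left]) (hx := hx) (hn := hn)
  rw [one_pow, Nat.add_sub_cancel_left, padicValNat.self hp.out.one_lt] at h
  rw [h, add_comm]

/-- `(1+p)ⁿ − 1 ≠ 0` for `n ≠ 0`. [folklore] -/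
theorem one_add_pow_sub_one_ne_zero {p : ℕ} [hp : Fact p.Prime] {n : ℕ} (hn : n ≠ 0) :
    (1 + p) ^ n - 1 ≠ 0 := by
  have : 1 < (1 + p) ^ n := Nat.one_lt_pow hn (by have := hp.out.one_lt; omega)
  omega

/-- **«depth-`m`» as a divisibility:** for an odd prime `p`, `n ≠ 0` and any `m`:
`p^m ∣ (1+p)ⁿ − 1 ⟺ m ≤ v_p(n) + 1` — the shape in which the `lcongr(m)` door (p573328) consumes the
depth of a Hida-family member. [folklore] -/
theorem pow_dvd_one_add_pow_sub_one_iff {p : ℕ} [hp : Fact p.Prime] (hodd : Odd p) {n : ℕ}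
    (hn : n ≠ 0) (m : ℕ) : p ^ m ∣ (1 + p) ^ n - 1 ↔ m ≤ padicValNat p n + 1 := by
  rw [padicValNat_dvd_iff_le (one_add_pow_sub_one_ne_zero hn), padicValNat_one_add_pow_sub_one hodd hn]

/-- In particular `p ∣ (1+p)ⁿ − 1` exactly to the first power when `p ∤ n` (depth `1`), and
`p^{v_p(n)+1}` always divides. [folklore] -/
theorem pow_padicValNat_succ_dvd_one_add_pow_sub_one {p : ℕ} [hp : Fact p.Prime] (hodd : Odd p)
    {n : ℕ} (hn : n ≠ 0) : p ^ (padicValNat p n + 1) ∣ (1 + p) ^ n - 1 :=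
  (pow_dvd_one_add_pow_sub_one_iff hodd hn _).mpr le_rfl

/-! ## §2. The ordinary root of the `p`-stabilisation, mod `p` -/

/-- **`X² − aX + p^{k−1} ≡ X·(X − a)` in `𝔽_p[X]` for `k ≥ 2`** — the characteristic polynomial of
`U_p` on the `p`-stabilised old line of an eigenform of weight `k` and `T_p`-eigenvalue `a`, reduced
mod `p`: its roots are `0` and `ā`, so the ordinary (unit) root is `≡ a` (MEMO-24 §1 (a)(i), «the
correction term carries `p^{k−1}`»). [folklore] -/
theorem stabilisation_charpoly_mod_p {p : ℕ} [Fact p.Prime] (a : ZMod p) {k : ℕ} (hk : 2 ≤ k) :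
    (Polynomial.X ^ 2 - Polynomial.C a * Polynomial.X + Polynomial.C ((p : ZMod p) ^ (k - 1)) :
      Polynomial (ZMod p)) = Polynomial.X * (Polynomial.X - Polynomial.C a) := by
  have hk' : k - 1 ≠ 0 := by omega
  rw [ZMod.natCast_self, zero_pow hk', map_zero, add_zero]
  ring

/-- The ordinary root: `ā` is a root of the reduced stabilisation polynomial (and `0` is the other).
[folklore] -/
theorem isRoot_stabilisation_charpoly_mod_p {p : ℕ} [Fact p.Prime] (a : ZMod p) {k : ℕ}
    (hk : 2 ≤ k) :
    (Polynomial.X ^ 2 - Polynomial.C a * Polynomial.X + Polynomial.C ((p : ZMod p) ^ (k - 1)) :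
      Polynomial (ZMod p)).IsRoot a := by
  rw [stabilisation_charpoly_mod_p a hk, Polynomial.IsRoot, Polynomial.eval_mul, Polynomial.eval_sub,
    Polynomial.eval_X, Polynomial.eval_C, sub_self, mul_zero]

/-! ## §3. Every lift of `Φ̄` reduces to ONE series under every weight (CLAIM 1–2 shadow) -/

section Reduction

variable {p : ℕ} [Fact p.Prime] {V : Type*} [AddCommGroup V] [Module (PowerSeries ℤ_[p]) V]

/-- **Congruent vectors have the same double reduction under a `Λ_S`-linear two-variable map.** For
`L : W → Λ_S⟦T⟧` `Λ_S`-linear and `Φ − Ψ ∈ 𝔪_{Λ_S}W`: `L Φ` and `L Ψ` agree mod `(p, S)`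
(p611136 `redFam_apply_eq_zero_of_mem` on the difference). [folklore] -/
theorem redFam_apply_eq_of_sub_mem (L : V →ₗ[PowerSeries ℤ_[p]] PowerSeries (PowerSeries ℤ_[p]))
    {Φ Ψ : V}
    (h : Φ - Ψ ∈ (maximalIdeal (PowerSeries ℤ_[p])) • (⊤ : Submodule (PowerSeries ℤ_[p]) V)) :
    PowerSeries.map ((residue ℤ_[p]).comp PowerSeries.constantCoeff) (L Φ) =
      PowerSeries.map ((residue ℤ_[p]).comp PowerSeries.constantCoeff) (L Ψ) := by
  rw [← sub_eq_zero, ← map_sub, ← map_sub]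
  exact GorensteinDefectCriterion.redFam_apply_eq_zero_of_mem L h

/-- **«All weights reduce through the same map `W → W̄ → 𝔽_p⟦T⟧`»** (MEMO-24 §1 (b) CLAIM 1, with the
algebraic shadow of CLAIM 2): for `Φ ≡ Ψ (mod 𝔪W)` and ANY two specialisations `φ₁, φ₂ : Λ_S → ℤ_p`,
`red (map φ₁ (L Φ)) = red (map φ₂ (L Ψ))` (p610475 `red_map_specialisation` + §3 above). So the mod-`p`
series of every member of every lift of `Φ̄` is one element of `𝔽_p⟦T⟧`. [folklore] -/
theorem red_map_apply_eq_of_sub_mem (L : V →ₗ[PowerSeries ℤ_[p]] PowerSeries (PowerSeries ℤ_[p]))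
    {Φ Ψ : V}
    (h : Φ - Ψ ∈ (maximalIdeal (PowerSeries ℤ_[p])) • (⊤ : Submodule (PowerSeries ℤ_[p]) V))
    (φ₁ φ₂ : PowerSeries ℤ_[p] →+* ℤ_[p]) :
    Summit.BirchSwinnertonDyer.Rank1Residual.X1.MuLambda.red (PowerSeries.map φ₁ (L Φ)) =
      Summit.BirchSwinnertonDyer.Rank1Residual.X1.MuLambda.red (PowerSeries.map φ₂ (L Ψ)) := by
  rw [HidaSpecialisationRigidity.red_map_specialisation,
    HidaSpecialisationRigidity.red_map_specialisation, redFam_apply_eq_of_sub_mem L h]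

end Reduction

end Summit.BirchSwinnertonDyer.BirchSwinnertonDyer.Theorems.HidaWeightBookkeeping

end
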